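import Summits.AnomalousDissipation.AnomalousDissipation.Theorems.SawtoothPulseCascadeK1LocalisedCascadeClassStepV

/-!
# K1loc, line `Spectral` / thin start — helper: THE SHELL-TYPE CLASS THROUGH A V HALF-STEP (ledger step A-V, one block)

Helper file of the prover lane on the crux `K1LocalisedCascade` (stmt-AnomalousDissipation-19491), route
`SawtoothPulseCascade` (S-D fibre ledger; memo v11 §13, inequality (A-V)).  First instance of `…ClassStepV.tsum_class_vstep_le` with a
fibre-dependent window: the shell-type class `A_{j+1}(X) = Σ'[X ≤ |k₀| ≤ |k₁|]‖𝓕a_{j+1}‖²` (modes at least as steep as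
`R = γ|k₁|/|k₀| ≥ γ`, above the threshold `X`), one block of fibres `X ≤ |k₁| ≤ Λ'`, plateau `p(n) = |n| + Q₂`:
**`tsum_shell_vstep_le`** —
`A_{j+1}(X) ≤ (((Q₁+Q₂)/(Q₂−Q₁))(ε₀ + A√(2N_j·4d₀)) + √(Σ'[X ≤ |k₁| ≤ Λ' ∧ Q₁ < |k₀|]‖𝓕b_j‖²))² + ((1+γ)^{2(j+1)}/Λ')²`,
`A = ((G+1)X + Q₂)/((G−1)X − Q₂)`, `τ = π/((G−1)X − Q₂)`, under `X + Q₂ < XG`, `8τ ≤ A d₀`, `Mδ_j < πN_j d₀`,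
`ε₀ ≥ A·πΛ'Ge^{−M²/2}/N_j`.  With `Q₁ ≥ 4Λ'`-type choices per block the pass-through class is the very shallow `b`-class `B_j(κX)`
of the ledger (threshold escalation); the choice is left to the assembly.  No definitions; no statement about the crux.
[cite: Grafakos2014, Prop. 3.1.2 (5), Prop. 3.2.7 (3), §3.1.3] [cite: ElgindiLissMattingly2025, §1 (slope ±1 branches)] [problem: turb]
-/

-- `Summit.<Summit>.<Problem>`: single-conjunct summit, the duplicate namespace segment is deliberate.
set_option linter.dupNamespace false

noncomputable section

namespace Summit.AnomalousDissipation.AnomalousDissipation.Theorems.SawtoothPulseCascade.K1Window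

open MeasureTheory Set Filter Topology UnitAddTorus Function Complex Metric
open scoped Real ENNReal
open Literature.Analysis Literature.Analysis.FunctionSpaces Literature.Analysis.FunctionSpaces.Torus Literature.Analysis.FluidPDE
open Literature.Analysis.FluidPDE.ShearStage
open Literature.Analysis.FluidPDE.SawtoothCascade Literature.Analysis.FluidPDE.SawtoothCascade.CascadeParams
open Summit.AnomalousDissipation.AnomalousDissipation.Theorems.SawtoothPulseCascade.K1Start
open Summit.AnomalousDissipation.AnomalousDissipation.Theorems.SawtoothPulseCascade.K1Flat
open Summit.AnomalousDissipation.AnomalousDissipation.Theorems.SawtoothPulseCascade.K1Ledger.From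

/-- The ratio `((G+1)x + Q)/((G−1)x − Q)` is decreasing in `x` on `(G−1)x > Q`. [folklore] -/
theorem shell_ratio_le {G Q x y : ℝ} (hxy : x ≤ y) (hx : Q < (G - 1) * x) (hQ : 0 ≤ Q) (hG : 1 ≤ G) :
    ((G + 1) * y + Q) / ((G - 1) * y - Q) ≤ ((G + 1) * x + Q) / ((G - 1) * x - Q) := by
  have hy : Q < (G - 1) * y := lt_of_lt_of_le hx (by nlinarith)
  rw [div_le_div_iff₀ (by linarith) (by linarith)]
  nlinarith [mul_le_mul_of_nonneg_left hxy hQ, mul_le_mul_of_nonneg_left hxy (by linarith : (0 : ℝ) ≤ G - 1)]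

section Cascade

variable (P : CascadeParams)

/-- **LEDGER STEP (A-V), one block** (see the file header). [cite: Grafakos2014, Prop. 3.1.2 (5), Prop. 3.2.7 (3), §3.1.3] -/
theorem tsum_shell_vstep_le {G : ℕ} (hγ : P.γ = G) (hδ₀ : 0 < P.δ₀) (hd : 0 < P.d) (hN₀ : 1 ≤ P.N₀) (hρN : 1 ≤ P.ρN)
    (a b : ℕ → UnitAddTorus (Fin 2) → ℝ) (has : ∀ j, IsSmooth (a j)) (h0 : a 0 = datum)
    (hb : ∀ j, b j = a j ∘ shearMap 0 1 (amp ⟨P.U j, P.U_periodic j, P.contDiff_U (P.δ_pos hδ₀ hd j)⟩ P.γ))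
    (hab : ∀ j, a (j + 1) = b j ∘ shearMap 1 0 (amp ⟨P.U j, P.U_periodic j, P.contDiff_U (P.δ_pos hδ₀ hd j)⟩ P.γ))
    (j : ℕ) {X Q₁ Q₂ Λ' : ℕ} (hQ : Q₁ < Q₂) (hX : X + Q₂ < X * G) (hXΛ : X ≤ Λ') (hΛ' : 0 < Λ')
    {d₀ M ε₀ : ℝ} (hd₀ : 0 < d₀) (hM : 1 ≤ M) (hMδ : M * P.δ j < π / 2) (hMd : M * P.δ j < π * P.N j * d₀)
    (hAd : 8 * (π / (((G : ℝ) - 1) * X - Q₂)) ≤ (((G : ℝ) + 1) * X + Q₂) / (((G : ℝ) - 1) * X - Q₂) * d₀)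
    (hε0 : 0 ≤ ε₀)
    (hε : (((G : ℝ) + 1) * X + Q₂) / (((G : ℝ) - 1) * X - Q₂) *
      (2 * π * ((Λ' * G : ℕ) : ℝ) * (Real.exp (-(M ^ 2 / 2)) / (2 * P.N j))) ≤ ε₀) :
    ∑' k : Fin 2 → ℤ, (if (X : ℤ) ≤ |k 0| ∧ |k 0| ≤ |k 1| then (1 : ℝ) else 0) *
        ‖mFourierCoeff (fun x => (a (j + 1) x : ℂ)) k‖ ^ 2 ≤
      ((((Q₁ : ℝ) + Q₂) / ((Q₂ : ℝ) - Q₁)) *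
            (ε₀ + (((G : ℝ) + 1) * X + Q₂) / (((G : ℝ) - 1) * X - Q₂) * Real.sqrt ((2 * P.N j : ℕ) * (4 * d₀))) +
          Real.sqrt (∑' k : Fin 2 → ℤ, (if (X : ℤ) ≤ |k 1| ∧ |k 1| ≤ Λ' ∧ (Q₁ : ℤ) < |k 0| then (1 : ℝ) else 0) *
            ‖mFourierCoeff (fun x => (b j x : ℂ)) k‖ ^ 2)) ^ 2 +
        ((1 + P.γ) ^ (2 * (j + 1)) / Λ') ^ 2 := by
  classical
  -- real-number facts about the block
  have hXr : (Q₂ : ℝ) < ((G : ℝ) - 1) * X := by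
    have : ((X + Q₂ : ℕ) : ℝ) < ((X * G : ℕ) : ℝ) := by exact_mod_cast hX
    push_cast at this; linarith
  have hX0 : 0 < X := by
    rcases Nat.eq_zero_or_pos X with h | h
    · subst h; simp at hX
    · exact h
  have hG1 : (1 : ℝ) ≤ G := by
    have : 1 ≤ G := by
      by_contra h; push Not at h; interval_cases G; simp at hX
    exact_mod_cast this
  set A : ℝ := (((G : ℝ) + 1) * X + Q₂) / (((G : ℝ) - 1) * X - Q₂) with hA
  have hA0 : 0 ≤ A := div_nonneg (by positivity) (by linarith)
  -- the window and the plateau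
  set p : ℤ → ℕ := fun n => n.natAbs + Q₂ with hp
  set W : Finset (Fin 2 → ℤ) := ((Finset.Icc (-(Λ' : ℤ)) Λ' ×ˢ Finset.Icc (-(Λ' : ℤ)) Λ').filter
      (fun q : ℤ × ℤ => (X : ℤ) ≤ |q.1| ∧ |q.1| ≤ |q.2| ∧ |q.2| ≤ Λ')).image
      (fun q : ℤ × ℤ => (fun i : Fin 2 => if i = 0 then q.1 else q.2)) with hWdef
  have hWall : ∀ k ∈ W, (X : ℤ) ≤ |k 0| ∧ |k 0| ≤ |k 1| ∧ |k 1| ≤ Λ' := by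
    intro k hk
    obtain ⟨q, hq, rfl⟩ := Finset.mem_image.mp hk
    have h := (Finset.mem_filter.mp hq).2
    simpa using h
  have hqW : ∀ k : Fin 2 → ℤ, ((X : ℤ) ≤ |k 0| ∧ |k 0| ≤ |k 1|) → |k 1| ≤ (Λ' : ℤ) → k ∈ W := by
    intro k hk h2
    refine Finset.mem_image.mpr ⟨(k 0, k 1), ?_, ?_⟩
    · refine Finset.mem_filter.mpr ⟨Finset.mem_product.mpr ⟨Finset.mem_Icc.mpr ?_, Finset.mem_Icc.mpr ?_⟩, hk.1, hk.2, h2⟩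
      · exact ⟨by linarith [neg_abs_le (k 0), hk.2], by linarith [le_abs_self (k 0), hk.2]⟩
      · exact ⟨by linarith [neg_abs_le (k 1)], by linarith [le_abs_self (k 1)]⟩
    · funext i; fin_cases i <;> simp
  have hW : ∀ k ∈ W, (X : ℤ) ≤ |k 1| ∧ |k 1| ≤ Λ' := fun k hk =>
    ⟨(hWall k hk).1.trans (hWall k hk).2.1, (hWall k hk).2.2⟩
  have hnat : ∀ k ∈ W, X ≤ (k 1).natAbs := fun k hk => by
    have h := (hW k hk).1
    rw [← Int.natCast_natAbs] at h
    exact_mod_cast h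
  have hWp : ∀ k ∈ W, |k 0| + Q₂ ≤ (p (k 1) : ℤ) := fun k hk => by
    simp only [hp, Nat.cast_add, Int.natCast_natAbs]
    linarith [(hWall k hk).2.1]
  have hpG : ∀ k ∈ W, p (k 1) < (k 1).natAbs * G := by
    intro k hk
    have h1 := hnat k hk
    have hG' : 1 ≤ G := by exact_mod_cast hG1
    -- `|n| + Q₂ < |n| G` from `X + Q₂ < X G` and `X ≤ |n|`
    have : X * G + ((k 1).natAbs - X) * 1 ≤ (k 1).natAbs * G := by
      have := Nat.mul_le_mul_left ((k 1).natAbs - X) hG'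
      have e : (k 1).natAbs * G = X * G + ((k 1).natAbs - X) * G := by
        rw [← Nat.add_mul, Nat.add_sub_cancel' h1]
      rw [e]; exact Nat.add_le_add_left this _
    simp only [hp]
    omega
  -- the kernel constants on the block
  have hden : ∀ k ∈ W, (Q₂ : ℝ) < ((G : ℝ) - 1) * ((k 1).natAbs : ℝ) := fun k hk => by
    have : (X : ℝ) ≤ (k 1).natAbs := by exact_mod_cast hnat k hk
    nlinarith
  have hA' : ∀ k ∈ W, ((p (k 1) : ℝ) + ((k 1).natAbs * G : ℕ)) / ((((k 1).natAbs * G : ℕ) : ℝ) - p (k 1)) ≤ A := by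
    intro k hk
    have hx : (X : ℝ) ≤ (k 1).natAbs := by exact_mod_cast hnat k hk
    have e1 : ((p (k 1) : ℝ) + ((k 1).natAbs * G : ℕ)) = ((G : ℝ) + 1) * ((k 1).natAbs : ℝ) + Q₂ := by
      simp only [hp]; push_cast; ring
    have e2 : ((((k 1).natAbs * G : ℕ) : ℝ) - p (k 1)) = ((G : ℝ) - 1) * ((k 1).natAbs : ℝ) - Q₂ := by
      simp only [hp]; push_cast; ring
    rw [e1, e2, hA]
    exact shell_ratio_le hx hXr (Nat.cast_nonneg _) hG1
  have hτ' : ∀ k ∈ W, π / ((((k 1).natAbs * G : ℕ) : ℝ) - p (k 1)) ≤ π / (((G : ℝ) - 1) * X - Q₂) := by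
    intro k hk
    have hx : (X : ℝ) ≤ (k 1).natAbs := by exact_mod_cast hnat k hk
    have e2 : ((((k 1).natAbs * G : ℕ) : ℝ) - p (k 1)) = ((G : ℝ) - 1) * ((k 1).natAbs : ℝ) - Q₂ := by
      simp only [hp]; push_cast; ring
    rw [e2]
    exact div_le_div_of_nonneg_left Real.pi_pos.le (by linarith) (by nlinarith)
  exact tsum_class_vstep_le P hγ hδ₀ hd hN₀ hρN a b has h0 hb hab j hQ hΛ' p _ W hqW hW hWp hpG hd₀ hM hMδ hMd hA0 hA'
    hτ' hAd hε0 hε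

end Cascade

end Summit.AnomalousDissipation.AnomalousDissipation.Theorems.SawtoothPulseCascade.K1Window
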